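import Summits.CriticalPhenomena.PercolationContinuityZ3.Theorems.PercNearOneGluingNoHeavyLowerTailSahiCombTriWAndClawPlusTwo

/-!
# AND with a claw with two doubled prongs, the small cases `k = 6, 7` (`clawPlusTwo p₁ q₁ p₂ q₂ = claw k ∪ {⊤∖{p₁,q₁}, ⊤∖{p₂,q₂}}`)

Support file of the one-cut programme (crux `NoHeavyLowerTail`, stmt-CriticalPhenomena-4575; unit `prim-lf-1` gen 49), completing the family
"claw with TWO prongs doubled" (`Q(2,2,1^m)` of the memo `FROM-prim-lf-1-gen49-CLAW.md` §3): `k = 5` is `…AndClawPlusTwo` (cocover5), `k ≥ 8` is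
`…AndClawPlusTwoGen` (one certificate), and here `k = 6` and `k = 7`, where the eight extreme sorted columns of the general certificate collide and the
exact symbol-cone LP gives slightly different (machine-found, human-sized) certificates `clawPlusTwo_cert_identity_6 / _7` — in both the claw row affords the
slack `½[c(g'+e') + (g+e)c']` (`g = s₂`, `e = s_{k-4}`, `c = s_{k-2}`) which the two extra columns `m ≤ M` consume via
`½sym(c, m+g) + ½sym(m+e, M) + ½sym(c−M, e−m)`.
* `corP_andProd_clawPlusTwo_nonneg_6`, `corP_andProd_clawPlusTwo_nonneg_7` (the all-sizes wrappers combining this file with `…AndClawPlusTwo` (`k = 5`) and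
  `…AndClawPlusTwoGen` (`k ≥ 8`) live in `…AndClawPlusTwoAll`).
HONEST LABEL: complete proofs, std axioms; no new definitions. [this work]
-/

namespace Summit.CriticalPhenomena.PercolationContinuityZ3.Theorems

namespace FiveUpSet

open Finset

variable {γ₁ : Type} [DecidableEq γ₁] [Fintype γ₁] {k : ℕ}

/-- The polynomial identity behind the `k = 6` two-prong certificate. [this work] -/
theorem clawPlusTwo_cert_identity_6 (u s0 s1 s2 s3 s4 s5 m M u' s0' s1' s2' s3' s4' s5' m' M' : ℤ) :
    2 * (u * u' + s0 * s5' + s1 * s4' + s2 * s3' + s3 * s2' + s4 * s1' + s5 * s0' + m * M' + M * m')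
      = ((u * (s0' + s1') + (s0 + s1) * u') + 2 * s3 * s3' + (s5 * (s0' + s1') + (s0 + s1) * s5') + (s4 * (m' + s2') + (m + s2) * s4') + ((m + s2) * M' + M * (m' + s2')))
        + (((s1 - s0) * (u' - s5') + (u - s5) * (s1' - s0')) + 2 * ((s2 - s1) * (s5' - s4') + (s5 - s4) * (s2' - s1')) + 2 * ((s2 - s1) * (u' - s5')
            + (u - s5) * (s2' - s1')) + 2 * ((s3 - s2) * (s4' - s3') + (s4 - s3) * (s3' - s2')) + 2 * ((s3 - s2) * (s5' - s4') + (s5 - s4) * (s3' - s2'))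
            + 2 * ((s3 - s2) * (u' - s5') + (u - s5) * (s3' - s2')) + 2 * (s4 - s3) * (s4' - s3') + 2 * ((s4 - s3) * (s5' - s4') + (s5 - s4) * (s4' - s3'))
            + 2 * ((s4 - s3) * (u' - s5') + (u - s5) * (s4' - s3')) + 2 * (s5 - s4) * (s5' - s4') + 2 * ((s5 - s4) * (u' - s5') + (u - s5) * (s5' - s4'))
            + 2 * (u - s5) * (u' - s5') + ((s4 - M) * (s2' - m') + (s2 - m) * (s4' - M'))) := by
  ring

/-- The polynomial identity behind the `k = 7` two-prong certificate. [this work] -/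
theorem clawPlusTwo_cert_identity_7 (u s0 s1 s2 s3 s4 s5 s6 m M u' s0' s1' s2' s3' s4' s5' s6' m' M' : ℤ) :
    2 * (u * u' + s0 * s6' + s1 * s5' + s2 * s4' + s3 * s3' + s4 * s2' + s5 * s1' + s6 * s0' + m * M' + M * m')
      = ((u * (s0' + s1') + (s0 + s1) * u') + (s2 * s4' + s4 * s2') + s3 * s3' + s4 * s4' + (s6 * (s0' + s1') + (s0 + s1) * s6') + (s5 * (m' + s2') + (m + s2) * s5')
          + ((m + s3) * M' + M * (m' + s3')))
        + (((s1 - s0) * (u' - s6') + (u - s6) * (s1' - s0')) + 2 * ((s2 - s1) * (s6' - s5') + (s6 - s5) * (s2' - s1')) + 2 * ((s2 - s1) * (u' - s6')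
            + (u - s6) * (s2' - s1')) + ((s3 - s2) * (s5' - s4') + (s5 - s4) * (s3' - s2')) + 2 * ((s3 - s2) * (s6' - s5') + (s6 - s5) * (s3' - s2'))
            + 2 * ((s3 - s2) * (u' - s6') + (u - s6) * (s3' - s2')) + (s4 - s3) * (s4' - s3') + 2 * ((s4 - s3) * (s5' - s4') + (s5 - s4) * (s4' - s3'))
            + 2 * ((s4 - s3) * (s6' - s5') + (s6 - s5) * (s4' - s3')) + 2 * ((s4 - s3) * (u' - s6') + (u - s6) * (s4' - s3')) + 2 * (s5 - s4) * (s5' - s4')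
            + 2 * ((s5 - s4) * (s6' - s5') + (s6 - s5) * (s5' - s4')) + 2 * ((s5 - s4) * (u' - s6') + (u - s6) * (s5' - s4')) + 2 * (s6 - s5) * (s6' - s5')
            + 2 * ((s6 - s5) * (u' - s6') + (u - s6) * (s6' - s5')) + 2 * (u - s6) * (u' - s6') + ((s5 - M) * (s3' - m') + (s3 - m) * (s5' - M'))) := by
  ring

section mainthm
variable {P₁ : Finset (Finset γ₁)} (hP : IsUpperSet (P₁ : Set (Finset γ₁))) (hd : Disjoint P₁ (refl P₁))
  (hcor : ∀ U V : Finset (Finset γ₁), IsUpperSet (U : Set (Finset γ₁)) → IsUpperSet (V : Set (Finset γ₁)) → 0 ≤ corP P₁ U V)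

include hP hd hcor in
/-- **THEOREM (AND with a claw with two doubled prongs, `k = 6`).** [this work] -/
theorem corP_andProd_clawPlusTwo_nonneg_6 {A B : Finset (Finset (γ₁ ⊕ Fin 6))} (hA : IsUpperSet (A : Set (Finset (γ₁ ⊕ Fin 6))))
    (hB : IsUpperSet (B : Set (Finset (γ₁ ⊕ Fin 6)))) {p₁ q₁ p₂ q₂ : Fin 6}
    (hpq : p₁ ≠ q₁ ∧ p₂ ≠ q₂ ∧ p₁ ≠ p₂ ∧ p₁ ≠ q₂ ∧ q₁ ≠ p₂ ∧ q₁ ≠ q₂) :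
    0 ≤ corP (andProd P₁ (clawPlusTwo p₁ q₁ p₂ q₂)) A B := by
  rw [corP_andProd_clawPlusTwo_eq hpq, corP_andProd_claw_eq]
  have r0 : Fin.rev (0 : Fin 6) = 5 := by decide
  have r1 : Fin.rev (1 : Fin 6) = 4 := by decide
  have r2 : Fin.rev (2 : Fin 6) = 3 := by decide
  have r3 : Fin.rev (3 : Fin 6) = 2 := by decide
  have r4 : Fin.rev (4 : Fin 6) = 1 := by decide
  have r5 : Fin.rev (5 : Fin 6) = 0 := by decide
  -- (1) pointwise: rearrangements
  have step1 : ∀ x ∈ P₁,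
      (clawU A x * clawU B x + clawS A x 0 * clawS B x 5 + clawS A x 1 * clawS B x 4 + clawS A x 2 * clawS B x 3 + clawS A x 3 * clawS B x 2 + clawS A x 4 * clawS B x 1
          + clawS A x 5 * clawS B x 0 + clawVmin A p₁ q₁ p₂ q₂ x * clawVmax B p₁ q₁ p₂ q₂ x + clawVmax A p₁ q₁ p₂ q₂ x * clawVmin B p₁ q₁ p₂ q₂ x)
      ≤ (clawV A p₁ q₁ x * clawV B p₁ q₁ x + clawV A p₂ q₂ x * clawV B p₂ q₂ x)
        + (clawU A x * clawU B x + ∑ i : Fin 6, clawW A i x * clawW B i x) := by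
    intro x _
    have hr := rearr_clawS A B x
    rw [Fin.sum_univ_six, r0, r1, r2, r3, r4, r5] at hr
    have hv := rearr_two (clawV A p₁ q₁ x) (clawV A p₂ q₂ x) (clawV B p₁ q₁ x) (clawV B p₂ q₂ x)
    unfold clawVmin clawVmax
    linarith
  -- (2) pointwise: certificate
  have step2 : ∀ x ∈ P₁,
      ((clawU A x * (clawS B x 0 + clawS B x 1) + (clawS A x 0 + clawS A x 1) * clawU B x) + (clawS A x 3 * clawS B x 3 + clawS A x 3 * clawS B x 3)
          + (clawS A x 5 * (clawS B x 0 + clawS B x 1) + (clawS A x 0 + clawS A x 1) * clawS B x 5) + (clawS A x 4 * (clawVmin B p₁ q₁ p₂ q₂ x + clawS B x 2)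
          + (clawVmin A p₁ q₁ p₂ q₂ x + clawS A x 2) * clawS B x 4) + ((clawVmin A p₁ q₁ p₂ q₂ x + clawS A x 2) * clawVmax B p₁ q₁ p₂ q₂ x
          + clawVmax A p₁ q₁ p₂ q₂ x * (clawVmin B p₁ q₁ p₂ q₂ x + clawS B x 2)))
      ≤ 2 * (clawU A x * clawU B x + clawS A x 0 * clawS B x 5 + clawS A x 1 * clawS B x 4 + clawS A x 2 * clawS B x 3 + clawS A x 3 * clawS B x 2
          + clawS A x 4 * clawS B x 1 + clawS A x 5 * clawS B x 0 + clawVmin A p₁ q₁ p₂ q₂ x * clawVmax B p₁ q₁ p₂ q₂ x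
          + clawVmax A p₁ q₁ p₂ q₂ x * clawVmin B p₁ q₁ p₂ q₂ x) := by
    intro x _
    have hid := clawPlusTwo_cert_identity_6 (clawU A x) (clawS A x 0) (clawS A x 1) (clawS A x 2) (clawS A x 3) (clawS A x 4) (clawS A x 5) (clawVmin A p₁ q₁ p₂ q₂ x)
        (clawVmax A p₁ q₁ p₂ q₂ x) (clawU B x) (clawS B x 0) (clawS B x 1) (clawS B x 2) (clawS B x 3) (clawS B x 4) (clawS B x 5) (clawVmin B p₁ q₁ p₂ q₂ x)
        (clawVmax B p₁ q₁ p₂ q₂ x)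
    have a_1_0 : 0 ≤ clawS A x 1 - clawS A x 0 := sub_nonneg.2 (clawS_monotone A x (by decide : (0 : Fin 6) ≤ 1))
    have b_1_0 : 0 ≤ clawS B x 1 - clawS B x 0 := sub_nonneg.2 (clawS_monotone B x (by decide : (0 : Fin 6) ≤ 1))
    have a_2_m : 0 ≤ clawS A x 2 - clawVmin A p₁ q₁ p₂ q₂ x := sub_nonneg.2 (clawVmin_le_clawS hA hpq x 2 rfl)
    have b_2_m : 0 ≤ clawS B x 2 - clawVmin B p₁ q₁ p₂ q₂ x := sub_nonneg.2 (clawVmin_le_clawS hB hpq x 2 rfl)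
    have a_2_1 : 0 ≤ clawS A x 2 - clawS A x 1 := sub_nonneg.2 (clawS_monotone A x (by decide : (1 : Fin 6) ≤ 2))
    have b_2_1 : 0 ≤ clawS B x 2 - clawS B x 1 := sub_nonneg.2 (clawS_monotone B x (by decide : (1 : Fin 6) ≤ 2))
    have a_3_2 : 0 ≤ clawS A x 3 - clawS A x 2 := sub_nonneg.2 (clawS_monotone A x (by decide : (2 : Fin 6) ≤ 3))
    have b_3_2 : 0 ≤ clawS B x 3 - clawS B x 2 := sub_nonneg.2 (clawS_monotone B x (by decide : (2 : Fin 6) ≤ 3))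
    have a_4_M : 0 ≤ clawS A x 4 - clawVmax A p₁ q₁ p₂ q₂ x := sub_nonneg.2 (clawVmax_le_clawS hA hpq x 4 rfl)
    have b_4_M : 0 ≤ clawS B x 4 - clawVmax B p₁ q₁ p₂ q₂ x := sub_nonneg.2 (clawVmax_le_clawS hB hpq x 4 rfl)
    have a_4_3 : 0 ≤ clawS A x 4 - clawS A x 3 := sub_nonneg.2 (clawS_monotone A x (by decide : (3 : Fin 6) ≤ 4))
    have b_4_3 : 0 ≤ clawS B x 4 - clawS B x 3 := sub_nonneg.2 (clawS_monotone B x (by decide : (3 : Fin 6) ≤ 4))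
    have a_5_4 : 0 ≤ clawS A x 5 - clawS A x 4 := sub_nonneg.2 (clawS_monotone A x (by decide : (4 : Fin 6) ≤ 5))
    have b_5_4 : 0 ≤ clawS B x 5 - clawS B x 4 := sub_nonneg.2 (clawS_monotone B x (by decide : (4 : Fin 6) ≤ 5))
    have a_u_5 : 0 ≤ clawU A x - clawS A x 5 := sub_nonneg.2 (clawS_le_clawU hA x 5)
    have b_u_5 : 0 ≤ clawU B x - clawS B x 5 := sub_nonneg.2 (clawS_le_clawU hB x 5)
    have n1 := mul_nonneg a_1_0 b_u_5
    have n2 := mul_nonneg a_u_5 b_1_0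
    have n3 := mul_nonneg a_2_1 b_5_4
    have n4 := mul_nonneg a_5_4 b_2_1
    have n5 := mul_nonneg a_2_1 b_u_5
    have n6 := mul_nonneg a_u_5 b_2_1
    have n7 := mul_nonneg a_3_2 b_4_3
    have n8 := mul_nonneg a_4_3 b_3_2
    have n9 := mul_nonneg a_3_2 b_5_4
    have n10 := mul_nonneg a_5_4 b_3_2
    have n11 := mul_nonneg a_3_2 b_u_5
    have n12 := mul_nonneg a_u_5 b_3_2
    have n13 := mul_nonneg a_4_3 b_4_3
    have n14 := mul_nonneg a_4_3 b_5_4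
    have n15 := mul_nonneg a_5_4 b_4_3
    have n16 := mul_nonneg a_4_3 b_u_5
    have n17 := mul_nonneg a_u_5 b_4_3
    have n18 := mul_nonneg a_5_4 b_5_4
    have n19 := mul_nonneg a_5_4 b_u_5
    have n20 := mul_nonneg a_u_5 b_5_4
    have n21 := mul_nonneg a_u_5 b_u_5
    have n22 := mul_nonneg a_4_M b_2_m
    have n23 := mul_nonneg a_2_m b_4_M
    linarith
  -- (3) acuteness
  have bS2 : ∀ (C : Finset (Finset (γ₁ ⊕ Fin 6))) (i j : Fin 6), ∀ x ∈ P₁, -2 ≤ clawS C x i + clawS C x j ∧ clawS C x i + clawS C x j ≤ 2 :=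
    fun C i j x _ => by have := clawS_bounds C x i; have := clawS_bounds C x j; constructor <;> linarith
  have bS1 : ∀ (C : Finset (Finset (γ₁ ⊕ Fin 6))) (j : Fin 6), ∀ x ∈ P₁, -2 ≤ clawS C x j ∧ clawS C x j ≤ 2 :=
    fun C j x _ => by have := clawS_bounds C x j; constructor <;> linarith
  have bU : ∀ (C : Finset (Finset (γ₁ ⊕ Fin 6))), ∀ x ∈ P₁, -2 ≤ clawU C x ∧ clawU C x ≤ 2 :=
    fun C x _ => by have := clawU_bounds (A := C) x; constructor <;> linarith
  have bmS : ∀ (C : Finset (Finset (γ₁ ⊕ Fin 6))) (j : Fin 6), ∀ x ∈ P₁,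
      -2 ≤ clawVmin C p₁ q₁ p₂ q₂ x + clawS C x j ∧ clawVmin C p₁ q₁ p₂ q₂ x + clawS C x j ≤ 2 :=
    fun C j x _ => by
      have := clawVmin_bounds (A := C) (p₁ := p₁) (q₁ := q₁) (p₂ := p₂) (q₂ := q₂) x; have := clawS_bounds C x j; constructor <;> linarith
  have bM : ∀ (C : Finset (Finset (γ₁ ⊕ Fin 6))), ∀ x ∈ P₁, -2 ≤ clawVmax C p₁ q₁ p₂ q₂ x ∧ clawVmax C p₁ q₁ p₂ q₂ x ≤ 2 :=
    fun C x _ => by have := clawVmax_bounds (A := C) (p₁ := p₁) (q₁ := q₁) (p₂ := p₂) (q₂ := q₂) x; constructor <;> linarith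
  have t1 := sum_mul_nonneg_of_two hP hd hcor (fun x => clawU A x) (fun x => clawS B x 0 + clawS B x 1) (bU A) (bS2 B 0 1)
    (fun x _ x' _ h => clawU_mono hA h) (fun x _ x' _ h => add_le_add (clawS_mono hB h 0) (clawS_mono hB h 1))
    (fun x _ x' _ h => clawU_add_clawU_nonneg hA h) (fun x _ x' _ h => clawS_add_pair hB h 0 1 (by decide))
  have t2 := sum_mul_nonneg_of_two hP hd hcor (fun x => clawS A x 0 + clawS A x 1) (fun x => clawU B x) (bS2 A 0 1) (bU B)
    (fun x _ x' _ h => add_le_add (clawS_mono hA h 0) (clawS_mono hA h 1)) (fun x _ x' _ h => clawU_mono hB h)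
    (fun x _ x' _ h => clawS_add_pair hA h 0 1 (by decide)) (fun x _ x' _ h => clawU_add_clawU_nonneg hB h)
  have t3 := sum_mul_nonneg_of_two hP hd hcor (fun x => clawS A x 3) (fun x => clawS B x 3) (bS1 A 3) (bS1 B 3)
    (fun x _ x' _ h => clawS_mono hA h 3) (fun x _ x' _ h => clawS_mono hB h 3)
    (fun x _ x' _ h => clawS_pair_self hA h 3 (by decide)) (fun x _ x' _ h => clawS_pair_self hB h 3 (by decide))
  have t4 := sum_mul_nonneg_of_two hP hd hcor (fun x => clawS A x 5) (fun x => clawS B x 0 + clawS B x 1) (bS1 A 5) (bS2 B 0 1)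
    (fun x _ x' _ h => clawS_mono hA h 5) (fun x _ x' _ h => add_le_add (clawS_mono hB h 0) (clawS_mono hB h 1))
    (fun x _ x' _ h => clawS_pair_self hA h 5 (by decide)) (fun x _ x' _ h => clawS_add_pair hB h 0 1 (by decide))
  have t5 := sum_mul_nonneg_of_two hP hd hcor (fun x => clawS A x 0 + clawS A x 1) (fun x => clawS B x 5) (bS2 A 0 1) (bS1 B 5)
    (fun x _ x' _ h => add_le_add (clawS_mono hA h 0) (clawS_mono hA h 1)) (fun x _ x' _ h => clawS_mono hB h 5)
    (fun x _ x' _ h => clawS_add_pair hA h 0 1 (by decide)) (fun x _ x' _ h => clawS_pair_self hB h 5 (by decide))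
  have t6 := sum_mul_nonneg_of_two hP hd hcor (fun x => clawS A x 4) (fun x => clawVmin B p₁ q₁ p₂ q₂ x + clawS B x 2) (bS1 A 4) (bmS B 2)
    (fun x _ x' _ h => clawS_mono hA h 4) (fun x _ x' _ h => add_le_add (clawVmin_mono hB h) (clawS_mono hB h 2))
    (fun x _ x' _ h => clawS_pair_self hA h 4 (by decide)) (fun x _ x' _ h => clawVmin_add_clawS_pair hB (p₁ := p₁) (q₁ := q₁) (p₂ := p₂) (q₂ := q₂) h 2 (by decide))
  have t7 := sum_mul_nonneg_of_two hP hd hcor (fun x => clawVmin A p₁ q₁ p₂ q₂ x + clawS A x 2) (fun x => clawS B x 4) (bmS A 2) (bS1 B 4)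
    (fun x _ x' _ h => add_le_add (clawVmin_mono hA h) (clawS_mono hA h 2)) (fun x _ x' _ h => clawS_mono hB h 4)
    (fun x _ x' _ h => clawVmin_add_clawS_pair hA (p₁ := p₁) (q₁ := q₁) (p₂ := p₂) (q₂ := q₂) h 2 (by decide)) (fun x _ x' _ h => clawS_pair_self hB h 4 (by decide))
  have t8 := sum_mul_nonneg_of_two hP hd hcor (fun x => clawVmin A p₁ q₁ p₂ q₂ x + clawS A x 2) (fun x => clawVmax B p₁ q₁ p₂ q₂ x) (bmS A 2) (bM B)
    (fun x _ x' _ h => add_le_add (clawVmin_mono hA h) (clawS_mono hA h 2)) (fun x _ x' _ h => clawVmax_mono hB h)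
    (fun x _ x' _ h => clawVmin_add_clawS_pair hA (p₁ := p₁) (q₁ := q₁) (p₂ := p₂) (q₂ := q₂) h 2 (by decide)) (fun x _ x' _ h => clawVmax_pair hB hpq h)
  have t9 := sum_mul_nonneg_of_two hP hd hcor (fun x => clawVmax A p₁ q₁ p₂ q₂ x) (fun x => clawVmin B p₁ q₁ p₂ q₂ x + clawS B x 2) (bM A) (bmS B 2)
    (fun x _ x' _ h => clawVmax_mono hA h) (fun x _ x' _ h => add_le_add (clawVmin_mono hB h) (clawS_mono hB h 2))
    (fun x _ x' _ h => clawVmax_pair hA hpq h) (fun x _ x' _ h => clawVmin_add_clawS_pair hB (p₁ := p₁) (q₁ := q₁) (p₂ := p₂) (q₂ := q₂) h 2 (by decide))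
  -- assemble
  have hKK := sum_le_sum step2
  rw [← mul_sum] at hKK
  simp only [sum_add_distrib] at hKK t1 t2 t3 t4 t5 t6 t7 t8 t9 ⊢
  have hrow := sum_le_sum step1
  simp only [sum_add_distrib] at hrow
  linarith

include hP hd hcor in
/-- **THEOREM (AND with a claw with two doubled prongs, `k = 7`).** [this work] -/
theorem corP_andProd_clawPlusTwo_nonneg_7 {A B : Finset (Finset (γ₁ ⊕ Fin 7))} (hA : IsUpperSet (A : Set (Finset (γ₁ ⊕ Fin 7))))
    (hB : IsUpperSet (B : Set (Finset (γ₁ ⊕ Fin 7)))) {p₁ q₁ p₂ q₂ : Fin 7}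
    (hpq : p₁ ≠ q₁ ∧ p₂ ≠ q₂ ∧ p₁ ≠ p₂ ∧ p₁ ≠ q₂ ∧ q₁ ≠ p₂ ∧ q₁ ≠ q₂) :
    0 ≤ corP (andProd P₁ (clawPlusTwo p₁ q₁ p₂ q₂)) A B := by
  rw [corP_andProd_clawPlusTwo_eq hpq, corP_andProd_claw_eq]
  have r0 : Fin.rev (0 : Fin 7) = 6 := by decide
  have r1 : Fin.rev (1 : Fin 7) = 5 := by decide
  have r2 : Fin.rev (2 : Fin 7) = 4 := by decide
  have r3 : Fin.rev (3 : Fin 7) = 3 := by decide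
  have r4 : Fin.rev (4 : Fin 7) = 2 := by decide
  have r5 : Fin.rev (5 : Fin 7) = 1 := by decide
  have r6 : Fin.rev (6 : Fin 7) = 0 := by decide
  -- (1) pointwise: rearrangements
  have step1 : ∀ x ∈ P₁,
      (clawU A x * clawU B x + clawS A x 0 * clawS B x 6 + clawS A x 1 * clawS B x 5 + clawS A x 2 * clawS B x 4 + clawS A x 3 * clawS B x 3 + clawS A x 4 * clawS B x 2
          + clawS A x 5 * clawS B x 1 + clawS A x 6 * clawS B x 0 + clawVmin A p₁ q₁ p₂ q₂ x * clawVmax B p₁ q₁ p₂ q₂ x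
          + clawVmax A p₁ q₁ p₂ q₂ x * clawVmin B p₁ q₁ p₂ q₂ x)
      ≤ (clawV A p₁ q₁ x * clawV B p₁ q₁ x + clawV A p₂ q₂ x * clawV B p₂ q₂ x)
        + (clawU A x * clawU B x + ∑ i : Fin 7, clawW A i x * clawW B i x) := by
    intro x _
    have hr := rearr_clawS A B x
    rw [Fin.sum_univ_seven, r0, r1, r2, r3, r4, r5, r6] at hr
    have hv := rearr_two (clawV A p₁ q₁ x) (clawV A p₂ q₂ x) (clawV B p₁ q₁ x) (clawV B p₂ q₂ x)
    unfold clawVmin clawVmax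
    linarith
  -- (2) pointwise: certificate
  have step2 : ∀ x ∈ P₁,
      ((clawU A x * (clawS B x 0 + clawS B x 1) + (clawS A x 0 + clawS A x 1) * clawU B x) + (clawS A x 2 * clawS B x 4 + clawS A x 4 * clawS B x 2)
          + clawS A x 3 * clawS B x 3 + clawS A x 4 * clawS B x 4 + (clawS A x 6 * (clawS B x 0 + clawS B x 1) + (clawS A x 0 + clawS A x 1) * clawS B x 6)
          + (clawS A x 5 * (clawVmin B p₁ q₁ p₂ q₂ x + clawS B x 2) + (clawVmin A p₁ q₁ p₂ q₂ x + clawS A x 2) * clawS B x 5) + ((clawVmin A p₁ q₁ p₂ q₂ x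
          + clawS A x 3) * clawVmax B p₁ q₁ p₂ q₂ x + clawVmax A p₁ q₁ p₂ q₂ x * (clawVmin B p₁ q₁ p₂ q₂ x + clawS B x 3)))
      ≤ 2 * (clawU A x * clawU B x + clawS A x 0 * clawS B x 6 + clawS A x 1 * clawS B x 5 + clawS A x 2 * clawS B x 4 + clawS A x 3 * clawS B x 3
          + clawS A x 4 * clawS B x 2 + clawS A x 5 * clawS B x 1 + clawS A x 6 * clawS B x 0 + clawVmin A p₁ q₁ p₂ q₂ x * clawVmax B p₁ q₁ p₂ q₂ x
          + clawVmax A p₁ q₁ p₂ q₂ x * clawVmin B p₁ q₁ p₂ q₂ x) := by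
    intro x _
    have hid := clawPlusTwo_cert_identity_7 (clawU A x) (clawS A x 0) (clawS A x 1) (clawS A x 2) (clawS A x 3) (clawS A x 4) (clawS A x 5) (clawS A x 6)
        (clawVmin A p₁ q₁ p₂ q₂ x) (clawVmax A p₁ q₁ p₂ q₂ x) (clawU B x) (clawS B x 0) (clawS B x 1) (clawS B x 2) (clawS B x 3) (clawS B x 4) (clawS B x 5) (clawS B x 6)
        (clawVmin B p₁ q₁ p₂ q₂ x) (clawVmax B p₁ q₁ p₂ q₂ x)
    have a_1_0 : 0 ≤ clawS A x 1 - clawS A x 0 := sub_nonneg.2 (clawS_monotone A x (by decide : (0 : Fin 7) ≤ 1))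
    have b_1_0 : 0 ≤ clawS B x 1 - clawS B x 0 := sub_nonneg.2 (clawS_monotone B x (by decide : (0 : Fin 7) ≤ 1))
    have a_2_1 : 0 ≤ clawS A x 2 - clawS A x 1 := sub_nonneg.2 (clawS_monotone A x (by decide : (1 : Fin 7) ≤ 2))
    have b_2_1 : 0 ≤ clawS B x 2 - clawS B x 1 := sub_nonneg.2 (clawS_monotone B x (by decide : (1 : Fin 7) ≤ 2))
    have a_3_m : 0 ≤ clawS A x 3 - clawVmin A p₁ q₁ p₂ q₂ x := sub_nonneg.2 (clawVmin_le_clawS hA hpq x 3 rfl)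
    have b_3_m : 0 ≤ clawS B x 3 - clawVmin B p₁ q₁ p₂ q₂ x := sub_nonneg.2 (clawVmin_le_clawS hB hpq x 3 rfl)
    have a_3_2 : 0 ≤ clawS A x 3 - clawS A x 2 := sub_nonneg.2 (clawS_monotone A x (by decide : (2 : Fin 7) ≤ 3))
    have b_3_2 : 0 ≤ clawS B x 3 - clawS B x 2 := sub_nonneg.2 (clawS_monotone B x (by decide : (2 : Fin 7) ≤ 3))
    have a_4_3 : 0 ≤ clawS A x 4 - clawS A x 3 := sub_nonneg.2 (clawS_monotone A x (by decide : (3 : Fin 7) ≤ 4))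
    have b_4_3 : 0 ≤ clawS B x 4 - clawS B x 3 := sub_nonneg.2 (clawS_monotone B x (by decide : (3 : Fin 7) ≤ 4))
    have a_5_M : 0 ≤ clawS A x 5 - clawVmax A p₁ q₁ p₂ q₂ x := sub_nonneg.2 (clawVmax_le_clawS hA hpq x 5 rfl)
    have b_5_M : 0 ≤ clawS B x 5 - clawVmax B p₁ q₁ p₂ q₂ x := sub_nonneg.2 (clawVmax_le_clawS hB hpq x 5 rfl)
    have a_5_4 : 0 ≤ clawS A x 5 - clawS A x 4 := sub_nonneg.2 (clawS_monotone A x (by decide : (4 : Fin 7) ≤ 5))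
    have b_5_4 : 0 ≤ clawS B x 5 - clawS B x 4 := sub_nonneg.2 (clawS_monotone B x (by decide : (4 : Fin 7) ≤ 5))
    have a_6_5 : 0 ≤ clawS A x 6 - clawS A x 5 := sub_nonneg.2 (clawS_monotone A x (by decide : (5 : Fin 7) ≤ 6))
    have b_6_5 : 0 ≤ clawS B x 6 - clawS B x 5 := sub_nonneg.2 (clawS_monotone B x (by decide : (5 : Fin 7) ≤ 6))
    have a_u_6 : 0 ≤ clawU A x - clawS A x 6 := sub_nonneg.2 (clawS_le_clawU hA x 6)
    have b_u_6 : 0 ≤ clawU B x - clawS B x 6 := sub_nonneg.2 (clawS_le_clawU hB x 6)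
    have n1 := mul_nonneg a_1_0 b_u_6
    have n2 := mul_nonneg a_u_6 b_1_0
    have n3 := mul_nonneg a_2_1 b_6_5
    have n4 := mul_nonneg a_6_5 b_2_1
    have n5 := mul_nonneg a_2_1 b_u_6
    have n6 := mul_nonneg a_u_6 b_2_1
    have n7 := mul_nonneg a_3_2 b_5_4
    have n8 := mul_nonneg a_5_4 b_3_2
    have n9 := mul_nonneg a_3_2 b_6_5
    have n10 := mul_nonneg a_6_5 b_3_2
    have n11 := mul_nonneg a_3_2 b_u_6
    have n12 := mul_nonneg a_u_6 b_3_2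
    have n13 := mul_nonneg a_4_3 b_4_3
    have n14 := mul_nonneg a_4_3 b_5_4
    have n15 := mul_nonneg a_5_4 b_4_3
    have n16 := mul_nonneg a_4_3 b_6_5
    have n17 := mul_nonneg a_6_5 b_4_3
    have n18 := mul_nonneg a_4_3 b_u_6
    have n19 := mul_nonneg a_u_6 b_4_3
    have n20 := mul_nonneg a_5_4 b_5_4
    have n21 := mul_nonneg a_5_4 b_6_5
    have n22 := mul_nonneg a_6_5 b_5_4
    have n23 := mul_nonneg a_5_4 b_u_6
    have n24 := mul_nonneg a_u_6 b_5_4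
    have n25 := mul_nonneg a_6_5 b_6_5
    have n26 := mul_nonneg a_6_5 b_u_6
    have n27 := mul_nonneg a_u_6 b_6_5
    have n28 := mul_nonneg a_u_6 b_u_6
    have n29 := mul_nonneg a_5_M b_3_m
    have n30 := mul_nonneg a_3_m b_5_M
    linarith
  -- (3) acuteness
  have bS2 : ∀ (C : Finset (Finset (γ₁ ⊕ Fin 7))) (i j : Fin 7), ∀ x ∈ P₁, -2 ≤ clawS C x i + clawS C x j ∧ clawS C x i + clawS C x j ≤ 2 :=
    fun C i j x _ => by have := clawS_bounds C x i; have := clawS_bounds C x j; constructor <;> linarith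
  have bS1 : ∀ (C : Finset (Finset (γ₁ ⊕ Fin 7))) (j : Fin 7), ∀ x ∈ P₁, -2 ≤ clawS C x j ∧ clawS C x j ≤ 2 :=
    fun C j x _ => by have := clawS_bounds C x j; constructor <;> linarith
  have bU : ∀ (C : Finset (Finset (γ₁ ⊕ Fin 7))), ∀ x ∈ P₁, -2 ≤ clawU C x ∧ clawU C x ≤ 2 :=
    fun C x _ => by have := clawU_bounds (A := C) x; constructor <;> linarith
  have bmS : ∀ (C : Finset (Finset (γ₁ ⊕ Fin 7))) (j : Fin 7), ∀ x ∈ P₁,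
      -2 ≤ clawVmin C p₁ q₁ p₂ q₂ x + clawS C x j ∧ clawVmin C p₁ q₁ p₂ q₂ x + clawS C x j ≤ 2 :=
    fun C j x _ => by
      have := clawVmin_bounds (A := C) (p₁ := p₁) (q₁ := q₁) (p₂ := p₂) (q₂ := q₂) x; have := clawS_bounds C x j; constructor <;> linarith
  have bM : ∀ (C : Finset (Finset (γ₁ ⊕ Fin 7))), ∀ x ∈ P₁, -2 ≤ clawVmax C p₁ q₁ p₂ q₂ x ∧ clawVmax C p₁ q₁ p₂ q₂ x ≤ 2 :=
    fun C x _ => by have := clawVmax_bounds (A := C) (p₁ := p₁) (q₁ := q₁) (p₂ := p₂) (q₂ := q₂) x; constructor <;> linarith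
  have t1 := sum_mul_nonneg_of_two hP hd hcor (fun x => clawU A x) (fun x => clawS B x 0 + clawS B x 1) (bU A) (bS2 B 0 1)
    (fun x _ x' _ h => clawU_mono hA h) (fun x _ x' _ h => add_le_add (clawS_mono hB h 0) (clawS_mono hB h 1))
    (fun x _ x' _ h => clawU_add_clawU_nonneg hA h) (fun x _ x' _ h => clawS_add_pair hB h 0 1 (by decide))
  have t2 := sum_mul_nonneg_of_two hP hd hcor (fun x => clawS A x 0 + clawS A x 1) (fun x => clawU B x) (bS2 A 0 1) (bU B)
    (fun x _ x' _ h => add_le_add (clawS_mono hA h 0) (clawS_mono hA h 1)) (fun x _ x' _ h => clawU_mono hB h)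
    (fun x _ x' _ h => clawS_add_pair hA h 0 1 (by decide)) (fun x _ x' _ h => clawU_add_clawU_nonneg hB h)
  have t3 := sum_mul_nonneg_of_two hP hd hcor (fun x => clawS A x 2) (fun x => clawS B x 4) (bS1 A 2) (bS1 B 4)
    (fun x _ x' _ h => clawS_mono hA h 2) (fun x _ x' _ h => clawS_mono hB h 4)
    (fun x _ x' _ h => clawS_pair_self hA h 2 (by decide)) (fun x _ x' _ h => clawS_pair_self hB h 4 (by decide))
  have t4 := sum_mul_nonneg_of_two hP hd hcor (fun x => clawS A x 4) (fun x => clawS B x 2) (bS1 A 4) (bS1 B 2)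
    (fun x _ x' _ h => clawS_mono hA h 4) (fun x _ x' _ h => clawS_mono hB h 2)
    (fun x _ x' _ h => clawS_pair_self hA h 4 (by decide)) (fun x _ x' _ h => clawS_pair_self hB h 2 (by decide))
  have t5 := sum_mul_nonneg_of_two hP hd hcor (fun x => clawS A x 3) (fun x => clawS B x 3) (bS1 A 3) (bS1 B 3)
    (fun x _ x' _ h => clawS_mono hA h 3) (fun x _ x' _ h => clawS_mono hB h 3)
    (fun x _ x' _ h => clawS_pair_self hA h 3 (by decide)) (fun x _ x' _ h => clawS_pair_self hB h 3 (by decide))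
  have t6 := sum_mul_nonneg_of_two hP hd hcor (fun x => clawS A x 4) (fun x => clawS B x 4) (bS1 A 4) (bS1 B 4)
    (fun x _ x' _ h => clawS_mono hA h 4) (fun x _ x' _ h => clawS_mono hB h 4)
    (fun x _ x' _ h => clawS_pair_self hA h 4 (by decide)) (fun x _ x' _ h => clawS_pair_self hB h 4 (by decide))
  have t7 := sum_mul_nonneg_of_two hP hd hcor (fun x => clawS A x 6) (fun x => clawS B x 0 + clawS B x 1) (bS1 A 6) (bS2 B 0 1)
    (fun x _ x' _ h => clawS_mono hA h 6) (fun x _ x' _ h => add_le_add (clawS_mono hB h 0) (clawS_mono hB h 1))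
    (fun x _ x' _ h => clawS_pair_self hA h 6 (by decide)) (fun x _ x' _ h => clawS_add_pair hB h 0 1 (by decide))
  have t8 := sum_mul_nonneg_of_two hP hd hcor (fun x => clawS A x 0 + clawS A x 1) (fun x => clawS B x 6) (bS2 A 0 1) (bS1 B 6)
    (fun x _ x' _ h => add_le_add (clawS_mono hA h 0) (clawS_mono hA h 1)) (fun x _ x' _ h => clawS_mono hB h 6)
    (fun x _ x' _ h => clawS_add_pair hA h 0 1 (by decide)) (fun x _ x' _ h => clawS_pair_self hB h 6 (by decide))
  have t9 := sum_mul_nonneg_of_two hP hd hcor (fun x => clawS A x 5) (fun x => clawVmin B p₁ q₁ p₂ q₂ x + clawS B x 2) (bS1 A 5) (bmS B 2)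
    (fun x _ x' _ h => clawS_mono hA h 5) (fun x _ x' _ h => add_le_add (clawVmin_mono hB h) (clawS_mono hB h 2))
    (fun x _ x' _ h => clawS_pair_self hA h 5 (by decide)) (fun x _ x' _ h => clawVmin_add_clawS_pair hB (p₁ := p₁) (q₁ := q₁) (p₂ := p₂) (q₂ := q₂) h 2 (by decide))
  have t10 := sum_mul_nonneg_of_two hP hd hcor (fun x => clawVmin A p₁ q₁ p₂ q₂ x + clawS A x 2) (fun x => clawS B x 5) (bmS A 2) (bS1 B 5)
    (fun x _ x' _ h => add_le_add (clawVmin_mono hA h) (clawS_mono hA h 2)) (fun x _ x' _ h => clawS_mono hB h 5)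
    (fun x _ x' _ h => clawVmin_add_clawS_pair hA (p₁ := p₁) (q₁ := q₁) (p₂ := p₂) (q₂ := q₂) h 2 (by decide)) (fun x _ x' _ h => clawS_pair_self hB h 5 (by decide))
  have t11 := sum_mul_nonneg_of_two hP hd hcor (fun x => clawVmin A p₁ q₁ p₂ q₂ x + clawS A x 3) (fun x => clawVmax B p₁ q₁ p₂ q₂ x) (bmS A 3) (bM B)
    (fun x _ x' _ h => add_le_add (clawVmin_mono hA h) (clawS_mono hA h 3)) (fun x _ x' _ h => clawVmax_mono hB h)
    (fun x _ x' _ h => clawVmin_add_clawS_pair hA (p₁ := p₁) (q₁ := q₁) (p₂ := p₂) (q₂ := q₂) h 3 (by decide)) (fun x _ x' _ h => clawVmax_pair hB hpq h)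
  have t12 := sum_mul_nonneg_of_two hP hd hcor (fun x => clawVmax A p₁ q₁ p₂ q₂ x) (fun x => clawVmin B p₁ q₁ p₂ q₂ x + clawS B x 3) (bM A) (bmS B 3)
    (fun x _ x' _ h => clawVmax_mono hA h) (fun x _ x' _ h => add_le_add (clawVmin_mono hB h) (clawS_mono hB h 3))
    (fun x _ x' _ h => clawVmax_pair hA hpq h) (fun x _ x' _ h => clawVmin_add_clawS_pair hB (p₁ := p₁) (q₁ := q₁) (p₂ := p₂) (q₂ := q₂) h 3 (by decide))
  -- assemble
  have hKK := sum_le_sum step2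
  rw [← mul_sum] at hKK
  simp only [sum_add_distrib] at hKK t1 t2 t3 t4 t5 t6 t7 t8 t9 t10 t11 t12 ⊢
  have hrow := sum_le_sum step1
  simp only [sum_add_distrib] at hrow
  linarith

end mainthm

end FiveUpSet

end Summit.CriticalPhenomena.PercolationContinuityZ3.Theorems
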